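import Summits.FinalStateConjecture.FinalStateConjecture.Theorems.StarvedNecksNecksCertifyRRelations

/-!
# Disproof of `GapDecaySuffices` (crux stmt-FinalStateConjecture-18060, route StarvedNecks) — findings

Standing crux-disprover work file (seat `refuter-cdisprove-stmt-FinalStateConjecture-18060-0`, cycle 1,
2026-08-17).  Prose only in docstrings; every `theorem` below is kernel-checked unless marked `sorry`
(none at present).  Published as `Cruxes/GapDecaySuffices/Disproof.lean`.

## Findings (index)

* §0 LOGICAL SHAPE.  `GapDecaySuffices` is the bare implication `NeckGapDecay → NecksCertifyR` between
  two closed universal statements.  `¬ GapDecaySuffices ↔ NeckGapDecay ∧ ¬ NecksCertifyR`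
  (`not_gapDecaySuffices_iff`): an UNCONDITIONAL kill would contain a proof of the physics crux
  `NeckGapDecay` (stmt-16768, open-problem-adjacent) — out of reach by design, so this crux cannot die
  by a counterexample; it can only die as a PLAN (its registered proof path) or by vacuity.  Vacuity
  directions recorded (`gapDecaySuffices_of_not_neckGapDecay`, `gapDecaySuffices_of_necksCertifyR`): if
  the physics crux is ever refuted (route kill criterion (1), a non-starving neck), this item becomes
  trivially TRUE and carries nothing.
* §1 THE LOAD-BEARING HYPOTHESIS OF THE ADVERTISED PROOF.  The planner's proof is `PosSoft ∘ p131681`: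
  `necksCertifyR_of_neckLedgerAnalysisPos` (landed) turns `PosCore` := "every honest `C⁴` input with
  pairwise distinct label velocities and `0 < d.N` admits a `NeckCertificate` (K1–K12)" into
  `NecksCertifyR`; `PosSoft` is to build that `NeckCertificate` from the gap certificates of
  `NeckGapDecay` FOR THE SAME INPUT.  `gapDecaySuffices_of_posCore` (kernel-checked here) isolates
  `PosCore` as the single load-bearing hypothesis of that plan.
* §2 MAIN FINDING — `PosCore` IS FALSE MODULO A LABEL-SWAPPED HONEST BINARY (`LabelSwapWitness`,
  `posCore_false_of_labelSwapWitness`, `labelSwapWitness_iff_not_posCore`).  The antecedent of the crux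
  (`FinalStateDecomposition` ∧ `O = exteriorOf` ∧ `Hc` ∧ `Hf` ∧ DV) is COVARIANT under relabelling the
  hole charts by a model Poincaré map `P = (L, p)` that permutes the label world-lines
  `ℓᵢ = {Λᵢ(s,0)+cᵢ}` AS A SET (chart `i ↦ Ψ_{σ i} ∘ P`, labels `(L⁻¹Λ_{σ i}, L⁻¹(c_{σ i} − p))`, flat
  chart and tubes unchanged as sets; the model-space identities are §3), whereas `NeckCertificate` is
  NOT: K5 pins `Ψₐᵢ` to the INPUT hole chart `i` inside `R₁+1` (physically: the hole that chart `i`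
  describes) and K6 pins `Ψₐᵢ = Φ` at the SAME MODEL POINTS on the collar `4ρₐᵢ ≤ rᵢ ≤ Rcᵢ+2` around
  the label line `ℓᵢ` (physically: the flat tube labelled `i`).  Nothing in the typed antecedent ties
  "the hole described by chart `i`" to "the flat tube labelled `i`": for two holes `A`, `B` with
  distinct velocities, swapping the labels (`P` = the proper orthochronous `π`-rotation exchanging
  `ℓ_A ↔ ℓ_B`, which exists for ANY two timelike lines with distinct velocities) gives an input that
  satisfies every clause of the antecedent verbatim (DV included: the LABEL velocities are still
  distinct), for which K4+K5+K6+K8+K10 are jointly unsatisfiable (a `C⁰`-honest chart on a model tube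
  of sublinear radius `Rc₁+2 = o(t)` would have to join hole `A`'s near zone to the flat collar around
  `B`, at physical distance `≍ |u_A − u_B|·t`; and the IVT point where that bridge crosses the flat
  shell `4ρₐ₂ ≤ r₂ ≤ 9ρₐ₂` around `ℓ₂ = ℓ_A` lies in `Ψₐ₂(U₂)` by K6 for label 2, against K10).
  This is EXACTLY the failure mode the v5 skeleton's own docstring records for a comoving binary
  ("the other hole sits inside the collar"), reproduced WITH distinct label velocities: the rev-3 repair
  C′ = DV-on-labels does not exclude it.  Labels are physical only UP TO A PERMUTATION of the label set
  (tube containment + no-dodging pin the SET of velocities, not the assignment; §2 docstring (D)).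
* CONSEQUENCES.  (i) `GapDecaySuffices` as a STATEMENT is not refuted and is plausibly still true:
  `NecksCertifyR`'s conclusion `∃ d₂ …` may un-permute the labels.  Sharper: a permuted input has the SAME
  `O`, the same charted set and hence the same `∃ d₂` conclusion of `NecksCertifyR` as the honest input it
  comes from — so label permutations add no failure point to `NecksCertifyR` or to the crux as STATEMENTS;
  they are FATAL only to the plan `PosSoft ∘ p131681`, which needs `NeckCertificate` for the given input.  (ii) But it is NOT "provable now by
  gauge geometry": any proof must either un-permute (a LabelMatching theorem: for every honest input
  there are `σ ∈ Sym(Fin N)` and Poincaré maps making a tube-matched honest input with the same `O` —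
  tube containment by curvature mismatch + no-dodging by a Jordan–Brouwer argument over the Causality
  API; topology, L–XL, not in the s1–s5 toolkit), or the antecedent must be STRENGTHENED.
  (iii) REPAIR (route kill criterion (3): "a fourth exotic honest gauge breaking K6 one-atlas ⇒ repair
  by a new item"): add the typed anchoring clause `TubeAnchored d R₀` (§4) to `HonestFar` — in G's
  conclusion (`HonestFixedRadiusSettlingT`), hence in the antecedents of `NeckGapDecay`, `NecksCertifyR`
  and inside `PosCore` (`PosCoreAnchored`, §4).  The swap witness violates `TubeAnchored` (the flat
  collar around `ℓ₁ = ℓ_B` lies near `B`, chart 1's honest-cell image is a quasi-ball around `A`), so it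
  MISSES the repaired statements; with anchoring, the transition map `Φ⁻¹ ∘ Ψg` on the overlap shell
  has translation `O(ρ)`, clock lag `o(t)` and bounded linear part, and PosSoft (s1–s5) goes through as audited
  (AUDIT-c4 §2; thin-shell worry settled in §5 below).  Capture theorems deliver `TubeAnchored` for free
  (both charts are near-isometric to one asymptotic frame with sublinear drift).
* §3 MODEL-SPACE COVARIANCE (kernel-checked bricks of the relabelling, reusable by the un-permuting
  prover): `poincareInv_relabel`, `boostedKerr_time_relabel`, `boostedKerr_radius_relabel`,
  `mem_boostedKerrExterior_relabel`, `boostedKerrBilin_relabel`.  LANDED Theorems-side: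
  `Theorems/GapDecaySuffices/Negative/PosCoreFalseOfLabelSwapWitness.lean` (p137241: §1–§3) and
  `Theorems/GapDecaySuffices/Negative/RelabelCovariance.lean` (p137850: the CHART-LEVEL analytic
  covariance — `deviation (B') (Ψ ∘ P) = (L×L)^* deviation (B) Ψ ∘ P`, all jets on `E4` compare with
  `‖L‖²‖L‖ᵐ`, `Cᵏ` sup norms over `P`-corresponding sets with `‖L‖² max(1,‖L‖)ᵏ`, hence the structure
  field `tendsto_truncDeviationCk` and the `C⁰` threshold of `Hf`(3) (slack `‖L‖²`) transfer to the
  relabelled chart) and `Theorems/GapDecaySuffices/Negative/RelabelDecomposition.lean` (p138268: the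
  STRUCTURE-LEVEL construction `d.relabel Δ` — charts `Ψᵢ ∘ P`, labels `(L⁻¹Λᵢ, L⁻¹(cᵢ−p))`, excisions
  `ρ_{π i}+C`, flat chart unchanged — is again a `FinalStateDecomposition` of the SAME `O` with the same
  charted set, and `antecedent_relabel`: `O = exteriorOf ∧ Hc ∧ Hf ∧ DV` transfer, `Hf`(3) with slack `‖L‖²`).
  So the ENTIRE clause-by-clause claim of §2 is kernel-checked, and the hold is pushed back accordingly:
  `Theorems/GapDecaySuffices/Negative/PosCoreFalseOfHonestPermutableWitness.lean` (p138566: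
  `HonestPermutableWitness` — an HONEST input + relabelling data whose relabelled input has no
  `NeckCertificate` — `→ LabelSwapWitness → ¬ PosCore`); what remains paper-level is only the no-bridge
  contradiction (K5/K6/K10 for the swapped binary).
* §4 REPAIR, TYPED: `TubeAnchored`, `PosCoreAnchored`, `posCoreAnchored_of_posCore` (the repaired stub is
  WEAKER than the refuted one, as it must be).
* §5 OTHER ATTACKS TRIED (docstring of `attacksTried`): junk-satisfiability of `NeckGapDecay`'s
  conclusion (no: G2 + smoothness across `r = R₁+1`); vacuity of the antecedent (no: N = 0 Minkowski
  inhabits it, and then everything is proved, p116183); bounded / negative excision profiles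
  (irrelevant here); thin-shell rigidity degradation (RESOLVED on paper in favour of the provers: John's
  rotation–strain theorem gives `|T − rigid| ≤ C ε₀ ρ` on bounded-ratio shells even when the local
  Lorentz fit wanders by O(1) through BMO-vortices, so the cutoff blend over length `ρ` costs strain
  `O(ε₀)`; the time-blend needs `ε₀ ρₐ/ρ → 0`, compatible with log-room `ρₐ/ρ → ∞` because `ρₐ` is
  chosen after `d`); garbage far-chart fingers into black-hole interiors and K12 (excluded on paper by
  the covering clause: a 3-ball floor cannot causally shadow an `S²`-essential interior region; the
  rattack seat's residual K10/K12 caveat stands as bookkeeping, not as a kill).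
* TARGETS: none registered on this crux yet (`ledger workitem stubs` empty, 2026-08-17T01:4xZ).

References: route file `Theses/StarvedNecks.lean` rev 7 (items -18060, -16768, -17574); landed
`Theorems/StarvedNecksNecksCertifyRRelations.lean` (p131681); v5 skeleton
`Cruxes/NecksCertify/Lines/two_cap_focusing_ledger.lean` (`NeckCertificate`, docstring l. 558–560);
`Cruxes/NecksCertify/NOTES.md` AUDIT-c4 §2 (families (A)(B)(C)); F. John, *Rotation and strain*,
CPAM 14 (1961) 391–413; Friesecke–James–Müller, CPAM 55 (2002); O'Neill 1983 Ch. 9 (Lorentz group);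
Dafermos–Luk arXiv:1710.01722 §1.2.1.
-/

noncomputable section

open scoped Manifold ContDiff Topology ENNReal
open Filter Set MeasureTheory Topology Literature.Geometry.Lorentzian

namespace Summit.FinalStateConjecture.FinalStateConjecture.Cruxes.GapDecaySuffices.Disproof

set_option linter.dupNamespace false

/-! ## §0 Logical shape of the crux -/

/-- The crux is literally the implication between the two sibling route decls. [folklore] -/
theorem gapDecaySuffices_iff :
    Theses.StarvedNecks.GapDecaySuffices ↔
      (Theses.StarvedNecks.NeckGapDecay → Theses.StarvedNecks.NecksCertifyR) :=
  Iff.rfl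

/-- **No counterexample can kill this crux without PROVING the physics crux**:
`¬ GapDecaySuffices ↔ NeckGapDecay ∧ ¬ NecksCertifyR`. [folklore] -/
theorem not_gapDecaySuffices_iff :
    ¬ Theses.StarvedNecks.GapDecaySuffices ↔
      (Theses.StarvedNecks.NeckGapDecay ∧ ¬ Theses.StarvedNecks.NecksCertifyR) := by
  constructor
  · intro h
    by_contra h'
    exact h fun hg ↦ Classical.by_contradiction fun hn ↦ h' ⟨hg, hn⟩
  · rintro ⟨hg, hn⟩ h
    exact hn (h hg)

/-- Vacuity direction 1: a refutation of the physics crux `NeckGapDecay` (route kill criterion (1))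
makes this item trivially true. [folklore] -/
theorem gapDecaySuffices_of_not_neckGapDecay (h : ¬ Theses.StarvedNecks.NeckGapDecay) :
    Theses.StarvedNecks.GapDecaySuffices :=
  fun h' ↦ (h h').elim

/-- Vacuity direction 2: a proof of the parent `NecksCertifyR` makes this item trivially true. [folklore] -/
theorem gapDecaySuffices_of_necksCertifyR (h : Theses.StarvedNecks.NecksCertifyR) :
    Theses.StarvedNecks.GapDecaySuffices :=
  fun _ ↦ h

/-! ## §1 The load-bearing hypothesis of the advertised proof: `PosCore` -/

/-- **`PosCore`** — the hypothesis of the landed reduction `necksCertifyR_of_neckLedgerAnalysisPos`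
(p131681) with its two PROVED model antecedents (`HuygensNeckLemma`, p104311/p111535; `KirchhoffFormula`,
p87050) dropped: for every admissible datum, MGHD, honest `C⁴` input (`O = exteriorOf`, `HonestCore`,
`HonestFar`) with pairwise distinct LABEL velocities and `0 < d.N`, a `NeckCertificate` (K1–K12 of the v5
skeleton, bundles VERBATIM those of p131681).  This is the statement of the registered physics stub
`stub_neckLedgerAnalysisPos` of `Cruxes/NecksCertify/Lines/two_cap_focusing_ledger.lean` minus the model
antecedents, and it is the TARGET of the planner's `PosSoft` (gap certificates ↦ `NeckCertificate` for the
same input). [folklore] -/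
def PosCore : Prop :=
    let HonestCore := fun (𝓢 : Spacetime.{0} 4) (O : Set 𝓢.carrier) (k : ℕ)
        (d : FinalStateDecomposition 𝓢 O k) (R₀ : ℝ) ↦
      let B := d.background; let t := fun i ↦ (B i).time; let r := fun i ↦ (B i).radius; let Ψ := d.chart;
      (∀ i, Kerr.IsSubextremal (d.mass i) (d.spin i) ∧ 100 * d.mass i ≤ R₀ ∧ 0 < ((d.motion i).1 : E4 ≃L[ℝ] E4) (E4.basisVector 0) 0) ∧
        (∀ i (ϱ τ₂ : ℝ), R₀ ≤ ϱ → d.τ₀ < τ₂ → Ψ i '' {x | d.τ₀ < t i x.1 ∧ t i x.1 < τ₂ ∧ r i x.1 < ϱ} ⊆ 𝓢.metric.causalPast 𝓢.timeOrientation (Ψ i '' (B i).truncTimeSlab ϱ τ₂)) ∧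
        (∀ i (τ' : ℝ) (ϱ : ℝ → ℝ), Continuous ϱ → d.τ₀ < τ' → let A := Ψ i '' {x | τ' ≤ t i x.1 ∧ r i x.1 ≤ ϱ (t i x.1)}; closure A ∩ O ⊆ A) ∧
        (∀ y : d.flatDomain, d.τ₀ < y.1 0 → 𝓢.timeOrientation.IsFutureDirected (mfderiv 𝓘(ℝ, E4) (𝓡 4) d.flatChart y (E4.basisVector 0)))
    let HonestFar := fun (𝓢 : Spacetime.{0} 4) (O : Set 𝓢.carrier) (k : ℕ)
        (d : FinalStateDecomposition 𝓢 O k) (R₀ : ℝ) ↦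
      let B := d.background; let t := fun i ↦ (B i).time; let r := fun i ↦ (B i).radius; let Φ := d.flatChart;
      (∀ τ₂ : ℝ, d.τ₀ < τ₂ → Φ '' {y | d.τ₀ < y.1 0 ∧ y.1 0 < τ₂} ⊆ 𝓢.metric.causalPast 𝓢.timeOrientation (Φ '' (Minkowski.backgroundOn d.flatDomain).timeSlab τ₂)) ∧
        (∀ τ' : ℝ, d.τ₀ < τ' → closure (Φ '' {y | τ' ≤ y.1 0 ∧ ∀ i, d.excision i (y.1 0) + 1 ≤ r i y.1}) ⊆ Φ '' {y | τ' ≤ y.1 0}) ∧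
        (∀ i, ∃ T : ℝ, supCkENorm (Subtype.val '' {x : (B i).domain | T ≤ t i x.1 ∧ R₀ ≤ r i x.1 ∧ ∀ j, j ≠ i → r i x.1 ≤ r j x.1}) 0 (𝓢.deviationExtend (B i) (d.chart i)) ≤ ENNReal.ofReal (1 / (10 * ‖(((d.motion i).1 : E4 ≃L[ℝ] E4) : E4 →L[ℝ] E4)‖ ^ 2)))
    let NeckCertificate := fun (𝓢 : Spacetime.{0} 4) (O : Set 𝓢.carrier) (d : FinalStateDecomposition 𝓢 O 4)
        (R₀ : ℝ) ↦
      let B := d.background; let t := fun i ↦ (B i).time; let r := fun i ↦ (B i).radius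
      let Λ := fun i ↦ ((d.motion i).1 : E4 ≃L[ℝ] E4); let Φ := d.flatChart; let Ψ := d.chart
      let ρ := d.excision
      ∃ (R₁ τ₁ : ℝ) (ρa Rc : Fin d.N → ℝ → ℝ) (Ψa : ∀ i, (B i).domain → 𝓢.carrier),
        R₀ ≤ R₁ ∧ d.τ₀ ≤ τ₁ ∧
        (∀ i, Monotone (ρa i) ∧ Continuous (ρa i) ∧ Tendsto (fun s ↦ ρa i s / s) atTop (𝓝 0) ∧
          Tendsto (ρa i) atTop atTop ∧ ∀ s, R₁ + 1 ≤ ρa i s ∧ (τ₁ ≤ s → ρ i s + 1 ≤ ρa i s)) ∧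
        (∀ i, Monotone (Rc i) ∧ Continuous (Rc i) ∧ Tendsto (fun s ↦ Rc i s / s) atTop (𝓝 0) ∧
          Tendsto (Rc i) atTop atTop ∧ ∀ s, R₁ + 4 ≤ Rc i s) ∧
        (∀ j (y : E4), τ₁ ≤ y 0 → r j y ≤ 9 * ρa j (y 0) → r j y + 3 ≤ Rc j (t j y)) ∧
        (∀ i, let U : Set (B i).domain := {x | τ₁ < t i x.1 ∧ r i x.1 < Rc i (t i x.1) + 2}
          ContMDiffOn 𝓘(ℝ, E4) (𝓡 4) ∞ (Ψa i) U ∧ IsOpenEmbedding (U.restrict (Ψa i)) ∧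
            Ψa i '' U ⊆ d.charted) ∧
        (∀ i (x : (B i).domain), r i x.1 ≤ R₁ + 1 → Ψa i x = Ψ i x) ∧
        (∀ i (y : E4) (hy : y ∈ (B i).domain), τ₁ ≤ y 0 → 4 * ρa i (y 0) ≤ r i y →
          r i y ≤ Rc i (t i y) + 2 → ∃ hy' : y ∈ d.flatDomain, Ψa i ⟨y, hy⟩ = Φ ⟨y, hy'⟩) ∧
        (∀ i, Tendsto (fun τ ↦ 𝓢.truncDeviationCk (B i) (Ψa i) 2 (Rc i τ) τ) atTop (𝓝 0)) ∧
        (∀ i, supCkENorm (Subtype.val '' {x : (B i).domain | τ₁ ≤ t i x.1 ∧ R₁ ≤ r i x.1 ∧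
            r i x.1 ≤ Rc i (t i x.1) + 2}) 0 (𝓢.deviationExtend (B i) (Ψa i)) ≤
          ENNReal.ofReal (1 / (10 * ‖(Λ i : E4 →L[ℝ] E4)‖ ^ 2))) ∧
        (∀ i (x : (B i).domain), τ₁ ≤ t i x.1 → R₁ ≤ r i x.1 → r i x.1 ≤ Rc i (t i x.1) + 2 →
          𝓢.timeOrientation.IsFutureDirected
            (mfderiv 𝓘(ℝ, E4) (𝓡 4) (Ψa i) x ((Λ i) (E4.basisVector 0)))) ∧
        (∀ i j, i ≠ j → Disjoint (Ψa i '' {x | τ₁ < t i x.1 ∧ r i x.1 < Rc i (t i x.1) + 2})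
          (Ψa j '' {x | τ₁ < t j x.1 ∧ r j x.1 < Rc j (t j x.1) + 2})) ∧
        (∀ i (τ' : ℝ) (ϱ : ℝ → ℝ), Continuous ϱ → τ₁ < τ' → (∀ s, ϱ s < Rc i s + 2) →
          closure (Ψa i '' {x | τ' ≤ t i x.1 ∧ r i x.1 ≤ ϱ (t i x.1)}) ∩ O ⊆
            Ψa i '' {x | τ' ≤ t i x.1 ∧ r i x.1 ≤ ϱ (t i x.1)}) ∧
        (∀ (T : ℝ) (Th : Fin d.N → ℝ), τ₁ < T → (∀ j, τ₁ < Th j) →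
          (∀ j (y : E4), T < y 0 → r j y ≤ Rc j (t j y) + 2 → Th j < t j y) →
          O \ (Φ '' {y | T < y.1 0 ∧ ∀ j, 5 * ρa j (y.1 0) < r j y.1} ∪
              ⋃ j, Ψa j '' {x | Th j < t j x.1 ∧ r j x.1 < Rc j (t j x.1) + 2}) ⊆
            𝓢.metric.causalPast 𝓢.timeOrientation
              (Φ '' {y | y.1 0 = T ∧ ∀ j, 5 * ρa j (y.1 0) < r j y.1} ∪
                ⋃ j, Ψa j '' {x | t j x.1 = Th j ∧ r j x.1 < Rc j (t j x.1) + 2}))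
      ∀ (X : Type) [TopologicalSpace X] [ChartedSpace E3 X] [IsManifold (𝓡 3) ∞ X] [ConnectedSpace X]
        (D : InitialDataSet (𝓡 3) X), D ∈ admissibleVacuumData X →
        ∀ 𝒟 : VacuumCauchyDevelopment D, 𝒟.IsMaximal →
        ∀ (O : Set 𝒟.carrier) (d : FinalStateDecomposition 𝒟.toSpacetime O 4) (R₀ : ℝ),
          O = exteriorOf 𝒟.toCauchyDevelopment d.charted →
          HonestCore 𝒟.toSpacetime O 4 d R₀ → HonestFar 𝒟.toSpacetime O 4 d R₀ →
          (∀ i j : Fin d.N, i ≠ j →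
            ((d.motion i).1 : E4 ≃L[ℝ] E4) (E4.basisVector 0) ≠ ((d.motion j).1 : E4 ≃L[ℝ] E4) (E4.basisVector 0)) →
          0 < d.N → NeckCertificate 𝒟.toSpacetime O d R₀

/-- `PosCore` feeds the landed reduction: `PosCore → NecksCertifyR` (p131681 with its model antecedents
discarded). [folklore] -/
theorem necksCertifyR_of_posCore (h : PosCore) : Theses.StarvedNecks.NecksCertifyR :=
  Theorems.NecksCertifyRRelations.necksCertifyR_of_neckLedgerAnalysisPos fun _ _ ↦ h

/-- **`PosCore` is the single load-bearing hypothesis of the advertised proof of the crux**: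
`PosCore → GapDecaySuffices` (the gap certificates are not even consulted — `PosSoft` is a route TO
`PosCore`'s conclusion for the given input, and that conclusion is what §2 breaks). [folklore] -/
theorem gapDecaySuffices_of_posCore (h : PosCore) : Theses.StarvedNecks.GapDecaySuffices :=
  gapDecaySuffices_of_necksCertifyR (necksCertifyR_of_posCore h)

/-! ## §2 Main finding: `PosCore` is false modulo a label-swapped honest binary -/

/-- **Hypothesis `H_swap` (physics-level; not constructible in the tree): a label-swapped honest
binary.**  With the bundles VERBATIM those of `PosCore`: there are an admissible datum, an MGHD, and an
honest `C⁴` input (`O = exteriorOf`, `HonestCore`, `HonestFar`, pairwise distinct label velocities,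
`0 < d.N`) admitting NO `NeckCertificate`.

INTENDED INHABITANT (paper; clause-by-clause check in this docstring).  Start from ANY honest two-hole
input `(Ψ_A, Ψ_B, Φ)` — labels `(Λ_A,c_A)`, `(Λ_B,c_B)` with distinct velocities, tubes `ρ_A, ρ_B`
continuous, hole charts covering their dark tube interiors and C⁰-honest on their Voronoi cells with
deviation → 0 there (slack), no garbage beyond — i.e. what the final state conjecture predicts for
non-comoving two-hole data.  Let `P x = L x + p` be a proper orthochronous Poincaré INVOLUTION of the
model space with `P ℓ_A = ℓ_B` (hence `P ℓ_B = ℓ_A`); one exists for any two timelike lines with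
distinct velocities: in the centre-of-velocity frame (velocities `±w ê_x`) rotate by `π` about an axis
`n ⊥ ê_x`, `n ⊥ (a_⊥ − b_⊥)`, through the midpoint `m = (a+b)/2`.  `P` is an exact `η`-isometry, so
rest-frame distances to the lines are preserved: `r_A ∘ P = r_B ± (|a_A|+|a_B|)` (oblate-radius slack
only).  SWAPPED INPUT `d_sw`: `N = 2`, same masses/spins, motions `(L⁻¹Λ_A, L⁻¹(c_A − p))` and
`(L⁻¹Λ_B, L⁻¹(c_B − p))`, charts `Ψ₁ := Ψ_A ∘ P`, `Ψ₂ := Ψ_B ∘ P` (domains `P⁻¹(dom_A)`, `P⁻¹(dom_B)`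
by `mem_boostedKerrExterior_relabel`), the SAME flat chart `Φ`, flat domain and `τ₀`, excisions
`ρ₁ := ρ_B + C`, `ρ₂ := ρ_A + C` (`C` = spin-mismatch slack of the oblate radius).  By §3,
`t₁ = t_A ∘ P`, `r₁ = r_A ∘ P` and `B₁.bilin x (v,w) = B_A.bilin (P x) (L v, L w)`, so: every model set
`{τ₀ < t₁ < τ₂, r₁ < ϱ}`, `truncTimeSlab`, `lateRegion`, `timeSlab` of label 1 is the `P`-preimage of
the corresponding set of `A`, and its `Ψ₁`-image is the `Ψ_A`-image of `A`'s set — IDENTICAL physical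
sets.  Hence: `isLateChart` ✓ (smooth ∘ affine; open embedding; same image), near-zone `C⁴` convergence ✓
(`dev₁ = (L×L)^* dev_A ∘ P`, jets bounded by `‖L‖^{m+2}`·jets of `dev_A`), `exists_pairwise_disjoint` ✓,
`tendsto_excision_div` ✓, `setOf_lt_excision_subset_flatDomain` ✓ (the label lines are `{ℓ_B, ℓ_A}`, the
new tubes contain the old), flat clauses and covering clause ✓ (unchanged sets), `O = exteriorOf` ✓
(`charted` unchanged), `Hc`(1) ✓ (`L⁻¹` proper orthochronous), `Hc`(2)(3) ✓ (identical image sets),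
`Hc`(4), `Hf`(1)(2) ✓ (flat chart unchanged; `{∀ i, ρᵢ+1 ≤ rᵢ}` shrinks), `Hf`(3) ✓ — the Voronoi cell
`{R₀ ≤ r₁ ≤ r₂}` is EXACTLY `P⁻¹` of `A`'s true cell `{R₀ ≤ r_A ≤ r_B}` (because `P` swaps the two
lines), `Ψ₁` there is `Ψ_A` on its own cell, and `‖dev₁‖ ≤ ‖L‖² ‖dev_A ∘ P‖ ≤ 1/(10‖L⁻¹Λ_A‖²)`
eventually by the slack; DV ✓ (`L⁻¹Λ_A e₀ ∦ L⁻¹Λ_B e₀`).  So `d_sw` satisfies the antecedent of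
`PosCore` verbatim — it is the honest input read through a symmetry of `η` that the typed clauses cannot
see.  WHY NO `NeckCertificate(d_sw)`: K5 gives `Ψₐ₁ = Ψ₁ = Ψ_A ∘ P` on `{r₁ ≤ R₁+1}` — physically hole
`A`; K6 gives `Ψₐ₁ y = Φ y` for model `y` with `4ρₐ₁(y⁰) ≤ r₁ y ≤ Rc₁+2` — model points near
`ℓ₁ = ℓ_B`, physically the flat collar around hole `B`; K4/K7/K8 make `Ψₐ₁` a `C⁰`-honest (10 %)
embedding of the CONNECTED model tube `{τ₁ < t₁, r₁ < Rc₁+2}` of radius `Rc₁+2 = o(t)` whose image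
therefore has lab extent `o(t)` around `B`'s collar while containing `A`'s near zone at lab distance
`≍ |u_A − u_B| t` — impossible for late slabs (the bridge cannot dive to flat times `< τ₁` either: clock
distortion along a C⁰-honest slab piece of model diameter `o(t)` is `o(t)`).  Sharper, via K10: follow
the `Ψₐ₁`-image of a model radial segment from `r₁ = R₁+1` to `r₁ = 4ρₐ₁`; its last exit from the dark
tube of `A` enters `Φ(late)` through `A`'s tube wall (`r_A ≈ ρ_A+1 < 4ρₐ₂`) and ends at `r_A ≍ ct >
9ρₐ₂`, so by the IVT it meets `Φ({4ρₐ₂ ≤ r₂ ≤ 9ρₐ₂})`, which K6 FOR LABEL 2 (`ℓ₂ = ℓ_A`) and K3 place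
inside `Ψₐ₂(U₂)` — contradicting K10.  (D) WHAT THE ANTECEDENT DOES PIN (paper): tube containment
(flat `C⁴` certification vs. Kerr curvature) forces the SET of physical asymptotic velocities into the SET
of label velocities, and `Hf`(3) on Voronoi cells forbids a chart's honest region to contain a companion
(no-dodging, Jordan–Brouwer in the slab), which makes the hole ↦ tube assignment a PERMUTATION `σ`
compatible with the velocity configuration up to the factor ≈ 0.35 of the 10 % threshold — for `N = 2`
no constraint at all.  `σ = id` is NOT forced: that is the content of this witness.

WHY `H_swap` IS NOT CONSTRUCTIBLE HERE: it needs an admissible datum WITH a maximal vacuum Cauchy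
development carrying two receding holes and honest charts (no two-black-hole MGHD is constructed in
print, let alone in the tree; in Minkowski space every honest decomposition has `N = 0`), exactly as for
the landed `…NecksCertify.Negative.ComovingPairWitness` (p121147).  Unlike that witness, this one
SURVIVES the rev-3 repair C′ (DV on labels) and every clause of rev 5–7.
[topic: Summits/FinalStateConjecture/FinalStateConjecture — multi-black-hole chart kinematics, label gauge] -/
def LabelSwapWitness : Prop :=
    let HonestCore := fun (𝓢 : Spacetime.{0} 4) (O : Set 𝓢.carrier) (k : ℕ)
        (d : FinalStateDecomposition 𝓢 O k) (R₀ : ℝ) ↦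
      let B := d.background; let t := fun i ↦ (B i).time; let r := fun i ↦ (B i).radius; let Ψ := d.chart;
      (∀ i, Kerr.IsSubextremal (d.mass i) (d.spin i) ∧ 100 * d.mass i ≤ R₀ ∧ 0 < ((d.motion i).1 : E4 ≃L[ℝ] E4) (E4.basisVector 0) 0) ∧
        (∀ i (ϱ τ₂ : ℝ), R₀ ≤ ϱ → d.τ₀ < τ₂ → Ψ i '' {x | d.τ₀ < t i x.1 ∧ t i x.1 < τ₂ ∧ r i x.1 < ϱ} ⊆ 𝓢.metric.causalPast 𝓢.timeOrientation (Ψ i '' (B i).truncTimeSlab ϱ τ₂)) ∧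
        (∀ i (τ' : ℝ) (ϱ : ℝ → ℝ), Continuous ϱ → d.τ₀ < τ' → let A := Ψ i '' {x | τ' ≤ t i x.1 ∧ r i x.1 ≤ ϱ (t i x.1)}; closure A ∩ O ⊆ A) ∧
        (∀ y : d.flatDomain, d.τ₀ < y.1 0 → 𝓢.timeOrientation.IsFutureDirected (mfderiv 𝓘(ℝ, E4) (𝓡 4) d.flatChart y (E4.basisVector 0)))
    let HonestFar := fun (𝓢 : Spacetime.{0} 4) (O : Set 𝓢.carrier) (k : ℕ)
        (d : FinalStateDecomposition 𝓢 O k) (R₀ : ℝ) ↦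
      let B := d.background; let t := fun i ↦ (B i).time; let r := fun i ↦ (B i).radius; let Φ := d.flatChart;
      (∀ τ₂ : ℝ, d.τ₀ < τ₂ → Φ '' {y | d.τ₀ < y.1 0 ∧ y.1 0 < τ₂} ⊆ 𝓢.metric.causalPast 𝓢.timeOrientation (Φ '' (Minkowski.backgroundOn d.flatDomain).timeSlab τ₂)) ∧
        (∀ τ' : ℝ, d.τ₀ < τ' → closure (Φ '' {y | τ' ≤ y.1 0 ∧ ∀ i, d.excision i (y.1 0) + 1 ≤ r i y.1}) ⊆ Φ '' {y | τ' ≤ y.1 0}) ∧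
        (∀ i, ∃ T : ℝ, supCkENorm (Subtype.val '' {x : (B i).domain | T ≤ t i x.1 ∧ R₀ ≤ r i x.1 ∧ ∀ j, j ≠ i → r i x.1 ≤ r j x.1}) 0 (𝓢.deviationExtend (B i) (d.chart i)) ≤ ENNReal.ofReal (1 / (10 * ‖(((d.motion i).1 : E4 ≃L[ℝ] E4) : E4 →L[ℝ] E4)‖ ^ 2)))
    let NeckCertificate := fun (𝓢 : Spacetime.{0} 4) (O : Set 𝓢.carrier) (d : FinalStateDecomposition 𝓢 O 4)
        (R₀ : ℝ) ↦
      let B := d.background; let t := fun i ↦ (B i).time; let r := fun i ↦ (B i).radius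
      let Λ := fun i ↦ ((d.motion i).1 : E4 ≃L[ℝ] E4); let Φ := d.flatChart; let Ψ := d.chart
      let ρ := d.excision
      ∃ (R₁ τ₁ : ℝ) (ρa Rc : Fin d.N → ℝ → ℝ) (Ψa : ∀ i, (B i).domain → 𝓢.carrier),
        R₀ ≤ R₁ ∧ d.τ₀ ≤ τ₁ ∧
        (∀ i, Monotone (ρa i) ∧ Continuous (ρa i) ∧ Tendsto (fun s ↦ ρa i s / s) atTop (𝓝 0) ∧
          Tendsto (ρa i) atTop atTop ∧ ∀ s, R₁ + 1 ≤ ρa i s ∧ (τ₁ ≤ s → ρ i s + 1 ≤ ρa i s)) ∧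
        (∀ i, Monotone (Rc i) ∧ Continuous (Rc i) ∧ Tendsto (fun s ↦ Rc i s / s) atTop (𝓝 0) ∧
          Tendsto (Rc i) atTop atTop ∧ ∀ s, R₁ + 4 ≤ Rc i s) ∧
        (∀ j (y : E4), τ₁ ≤ y 0 → r j y ≤ 9 * ρa j (y 0) → r j y + 3 ≤ Rc j (t j y)) ∧
        (∀ i, let U : Set (B i).domain := {x | τ₁ < t i x.1 ∧ r i x.1 < Rc i (t i x.1) + 2}
          ContMDiffOn 𝓘(ℝ, E4) (𝓡 4) ∞ (Ψa i) U ∧ IsOpenEmbedding (U.restrict (Ψa i)) ∧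
            Ψa i '' U ⊆ d.charted) ∧
        (∀ i (x : (B i).domain), r i x.1 ≤ R₁ + 1 → Ψa i x = Ψ i x) ∧
        (∀ i (y : E4) (hy : y ∈ (B i).domain), τ₁ ≤ y 0 → 4 * ρa i (y 0) ≤ r i y →
          r i y ≤ Rc i (t i y) + 2 → ∃ hy' : y ∈ d.flatDomain, Ψa i ⟨y, hy⟩ = Φ ⟨y, hy'⟩) ∧
        (∀ i, Tendsto (fun τ ↦ 𝓢.truncDeviationCk (B i) (Ψa i) 2 (Rc i τ) τ) atTop (𝓝 0)) ∧
        (∀ i, supCkENorm (Subtype.val '' {x : (B i).domain | τ₁ ≤ t i x.1 ∧ R₁ ≤ r i x.1 ∧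
            r i x.1 ≤ Rc i (t i x.1) + 2}) 0 (𝓢.deviationExtend (B i) (Ψa i)) ≤
          ENNReal.ofReal (1 / (10 * ‖(Λ i : E4 →L[ℝ] E4)‖ ^ 2))) ∧
        (∀ i (x : (B i).domain), τ₁ ≤ t i x.1 → R₁ ≤ r i x.1 → r i x.1 ≤ Rc i (t i x.1) + 2 →
          𝓢.timeOrientation.IsFutureDirected
            (mfderiv 𝓘(ℝ, E4) (𝓡 4) (Ψa i) x ((Λ i) (E4.basisVector 0)))) ∧
        (∀ i j, i ≠ j → Disjoint (Ψa i '' {x | τ₁ < t i x.1 ∧ r i x.1 < Rc i (t i x.1) + 2})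
          (Ψa j '' {x | τ₁ < t j x.1 ∧ r j x.1 < Rc j (t j x.1) + 2})) ∧
        (∀ i (τ' : ℝ) (ϱ : ℝ → ℝ), Continuous ϱ → τ₁ < τ' → (∀ s, ϱ s < Rc i s + 2) →
          closure (Ψa i '' {x | τ' ≤ t i x.1 ∧ r i x.1 ≤ ϱ (t i x.1)}) ∩ O ⊆
            Ψa i '' {x | τ' ≤ t i x.1 ∧ r i x.1 ≤ ϱ (t i x.1)}) ∧
        (∀ (T : ℝ) (Th : Fin d.N → ℝ), τ₁ < T → (∀ j, τ₁ < Th j) →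
          (∀ j (y : E4), T < y 0 → r j y ≤ Rc j (t j y) + 2 → Th j < t j y) →
          O \ (Φ '' {y | T < y.1 0 ∧ ∀ j, 5 * ρa j (y.1 0) < r j y.1} ∪
              ⋃ j, Ψa j '' {x | Th j < t j x.1 ∧ r j x.1 < Rc j (t j x.1) + 2}) ⊆
            𝓢.metric.causalPast 𝓢.timeOrientation
              (Φ '' {y | y.1 0 = T ∧ ∀ j, 5 * ρa j (y.1 0) < r j y.1} ∪
                ⋃ j, Ψa j '' {x | t j x.1 = Th j ∧ r j x.1 < Rc j (t j x.1) + 2}))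
    ∃ (X : Type) (_ : TopologicalSpace X) (_ : ChartedSpace E3 X) (_ : IsManifold (𝓡 3) ∞ X)
      (_ : ConnectedSpace X) (D : InitialDataSet (𝓡 3) X) (_ : D ∈ admissibleVacuumData X)
      (𝒟 : VacuumCauchyDevelopment D) (_ : 𝒟.IsMaximal)
      (O : Set 𝒟.carrier) (d : FinalStateDecomposition 𝒟.toSpacetime O 4) (R₀ : ℝ),
      O = exteriorOf 𝒟.toCauchyDevelopment d.charted ∧
      HonestCore 𝒟.toSpacetime O 4 d R₀ ∧ HonestFar 𝒟.toSpacetime O 4 d R₀ ∧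
      (∀ i j : Fin d.N, i ≠ j →
        ((d.motion i).1 : E4 ≃L[ℝ] E4) (E4.basisVector 0) ≠ ((d.motion j).1 : E4 ≃L[ℝ] E4) (E4.basisVector 0)) ∧
      0 < d.N ∧ ¬ NeckCertificate 𝒟.toSpacetime O d R₀

/-- **NEGATIVE LEMMA MODULO `H_swap`: the registered stub / the hypothesis of p131681 is false as soon as
a label-swapped honest binary exists** — `LabelSwapWitness → ¬ PosCore`.  Apply `PosCore` to the witness
input. [folklore] -/
theorem posCore_false_of_labelSwapWitness (hH : LabelSwapWitness) : ¬ PosCore := by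
  intro hPos
  obtain ⟨X, i₁, i₂, i₃, i₄, D, hD, 𝒟, h𝒟, O, d, R₀, hO, hc, hf, hDV, hN, hno⟩ := hH
  exact hno (hPos X D hD 𝒟 h𝒟 O d R₀ hO hc hf hDV hN)

/-- Honesty about the hold: `H_swap` is the WEAKEST hypothesis refuting `PosCore` —
`LabelSwapWitness ↔ ¬ PosCore`; the content is the paper inhabitant of the docstring of
`LabelSwapWitness`, not this equivalence. [folklore] -/
theorem labelSwapWitness_iff_not_posCore : LabelSwapWitness ↔ ¬ PosCore := by
  refine ⟨posCore_false_of_labelSwapWitness, fun h ↦ ?_⟩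
  by_contra hW
  refine h ?_
  intro X i₁ i₂ i₃ i₄ D hD 𝒟 h𝒟 O d R₀ hO hc hf hDV hN
  by_contra hno
  exact hW ⟨X, i₁, i₂, i₃, i₄, D, hD, 𝒟, h𝒟, O, d, R₀, hO, hc, hf, hDV, hN, hno⟩

/-! ## §3 Model-space covariance of the boosted Kerr–Schild labels under a Poincaré relabelling

`P x = L x + p` with `L ∈ lorentzGroup`: the label `(L⁻¹Λ, L⁻¹(c − p))` has rest-frame coordinates
`poincareInv` equal to those of `(Λ, c)` AFTER `P`; hence time, radius, exterior domain and reference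
form all transform by precomposition with `P` (the form also by `(L × L)`-pullback).  These five identities
are the whole formal content of "relabelling covariance" at the level of the backgrounds; the chart-level
statements (§2 docstring) are their compositions with `Ψ ∘ P`. -/

section Covariance

variable (Λ L : lorentzGroup) (c p : E4)

/-- Group law of `lorentzGroup ≤ (E4 ≃L[ℝ] E4)` (automorphism group: `(f * g) v = f (g v)`,
`f⁻¹ = f.symm`) applied to rest-frame coordinates: the relabelled inverse Poincaré map is the old one
after `P`.  O'Neill 1983, Ch. 9, p. 236. [cite: ONeill1983, Ch. 9  p. 236] -/
theorem poincareInv_relabel (x : E4) :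
    poincareInv (L⁻¹ * Λ) ((L : E4 ≃L[ℝ] E4).symm (c - p)) x =
      poincareInv Λ c ((L : E4 ≃L[ℝ] E4) x + p) := by
  simp only [poincareInv]
  have h1 : ∀ u : E4, (((L⁻¹ * Λ : lorentzGroup) : E4 ≃L[ℝ] E4).symm) u =
      (Λ : E4 ≃L[ℝ] E4).symm ((L : E4 ≃L[ℝ] E4) u) := fun u ↦ rfl
  have h2 : (L : E4 ≃L[ℝ] E4) ((L : E4 ≃L[ℝ] E4).symm (c - p)) = c - p :=
    (L : E4 ≃L[ℝ] E4).apply_symm_apply (c - p)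
  rw [h1, map_sub, h2]
  congr 1
  abel

/-- Rest-frame time of the relabelled background = old rest-frame time after `P`. [folklore] -/
theorem boostedKerr_time_relabel (M a : ℝ) (x : E4) :
    (boostedKerrBackground (L⁻¹ * Λ) ((L : E4 ≃L[ℝ] E4).symm (c - p)) M a).time x =
      (boostedKerrBackground Λ c M a).time ((L : E4 ≃L[ℝ] E4) x + p) := by
  simp only [boostedKerrBackground, poincareInv_relabel]

/-- Rest-frame Kerr–Schild radius of the relabelled background = old radius after `P`; in particular
the Voronoi cells `{rᵢ ≤ rⱼ}` of a relabelled input are the `P`-preimages of the old cells. [folklore] -/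
theorem boostedKerr_radius_relabel (M a : ℝ) (x : E4) :
    (boostedKerrBackground (L⁻¹ * Λ) ((L : E4 ≃L[ℝ] E4).symm (c - p)) M a).radius x =
      (boostedKerrBackground Λ c M a).radius ((L : E4 ≃L[ℝ] E4) x + p) := by
  simp only [boostedKerrBackground, poincareInv_relabel]

/-- The relabelled exterior domain is the `P`-preimage of the old one. [folklore] -/
theorem mem_boostedKerrExterior_relabel (M a : ℝ) (x : E4) :
    x ∈ boostedKerrExterior (L⁻¹ * Λ) ((L : E4 ≃L[ℝ] E4).symm (c - p)) M a ↔
      (L : E4 ≃L[ℝ] E4) x + p ∈ boostedKerrExterior Λ c M a := by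
  simp only [mem_boostedKerrExterior, poincareInv_relabel]

/-- The relabelled reference form is the `(L × L)`-pullback of the old one after `P`:
`g_{(L⁻¹Λ, L⁻¹(c−p))}(x)(v, w) = g_{(Λ,c)}(L x + p)(L v, L w)` — so a chart `Ψ ∘ P` deviates from the
relabelled background by the `(L × L)`-pullback of the deviation of `Ψ` from the old one (Kerr–Schild
1965, Lorentz covariance of the ansatz). [cite: KerrSchild1965, (Lorentz covariance of the Kerr–Schild a] -/
theorem boostedKerrBilin_relabel (M a : ℝ) (x v w : E4) :
    boostedKerrBilin (L⁻¹ * Λ) ((L : E4 ≃L[ℝ] E4).symm (c - p)) M a x v w =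
      boostedKerrBilin Λ c M a ((L : E4 ≃L[ℝ] E4) x + p) ((L : E4 ≃L[ℝ] E4) v)
        ((L : E4 ≃L[ℝ] E4) w) := by
  rw [boostedKerrBilin_apply, boostedKerrBilin_apply, poincareInv_relabel]
  have h1 : ∀ u : E4, (((L⁻¹ * Λ : lorentzGroup) : E4 ≃L[ℝ] E4).symm) u =
      (Λ : E4 ≃L[ℝ] E4).symm ((L : E4 ≃L[ℝ] E4) u) := fun u ↦ rfl
  rw [h1, h1]

end Covariance

/-! ## §4 The repair, typed -/

/-- **`TubeAnchored d R₀`** — the anchoring clause whose absence §2 exploits (proposed `Hf`(4) for the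
INPUT bundle `HonestFar`, i.e. for G's conclusion and the antecedents of `NeckGapDecay` / `NecksCertifyR`
/ `PosCore`): eventually in flat time, the flat chart's image of the model collar
`3ρᵢ(y⁰) + R₀ ≤ rᵢ y ≤ 4ρᵢ(y⁰) + R₀` around label line `i` lies inside hole chart `i`'s image of its
HONEST region `{R₀ ≤ rᵢ, rᵢ ≤ rⱼ ∀ j ≠ i}` (the Voronoi cell of `Hf`(3)) — "the flat collar of tube `i`
is seen by hole chart `i`".  Design: purely set-theoretic (no metric on `O`); NO clock comparison (an
honest hole chart's lab clock may lag the flat clock by an unbounded `o(t)`, so a time window would be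
unsatisfiable), tolerant of drift `|ξᵢ| < ρᵢ` and of small tubes (the collar sits at physical distance
`≥ 2ρᵢ + R₀` from the hole, inside the `C⁰`-honest zone, and at `≤ 5ρᵢ + R₀ ≪` half the separation,
inside the cell, eventually); NOT relabelling-covariant — the swap of §2 violates it (the flat collar
around `ℓ₁ = ℓ_B` lies within `5ρ₁+R₀` of `B`, while `Ψ₁`'s cell image is the quasi-ball of radius
`≈ 0.55·dist(ℓ_A,ℓ_B)` around `A`); delivered by every capture theorem and by any honest input whose
hole charts are near-isometric to the asymptotic frame of `Φ` on their cells (Jordan–Brouwer: the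
quasi-image of the cell shell contains the physical shell `(1.1R₀, 0.45 d)` around hole `i`).  With it,
tube containment forces `σ = id`, hence drift `< ρᵢ`, hence `Φ⁻¹ ∘ Ψg` on the overlap shell
`(2ρᵢ, 3ρᵢ)` of `NeckGapDecay`'s certificate has translation `O(ρᵢ)`, sublinear clock lag and bounded
linear part — all that PosSoft (AUDIT-c4 §2, s1–s5) consumes.  NOTE FOR THE ANCHORING CARDS
(`Ideas/curvature-anchored-location.md`, `Ideas/neck-timeline-anchoring.md`, which isolate FIRST CONTACT /
the ANCHOR as the unfilled step and propose an image clause `Ψg '' shell ⊆ d.radiationZone` as G6): a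
LABEL-BLIND image clause is NOT enough — the label-swapped binary of §2 satisfies it (the shell of `Ψg₁`
around hole `A` lies in the radiation zone, around the flat tube labelled 2) and still admits no
`NeckCertificate`; anchored clopen continuation from a label-blind first contact locates `Ψg`'s shell near
SOME axis `π(i)`, not near axis `i`.  The anchor must be LABEL-SPECIFIC at the level of MODEL POINTS, as K6 is:
`TubeAnchored` below (or G6′: `Ψg '' {x ∈ U | 2ρᵢ(x⁰)+2 ≤ rᵢ x ≤ W(x⁰)} ⊆ Φ '' {y | rᵢ y ≤ 4ρᵢ(y⁰) + …}` with
the SAME `rᵢ`). [folklore] -/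
def TubeAnchored {𝓢 : Spacetime.{0} 4} {O : Set 𝓢.carrier} {k : ℕ}
    (d : FinalStateDecomposition 𝓢 O k) (R₀ : ℝ) : Prop :=
  ∀ i, ∃ T : ℝ, ∀ y : d.flatDomain, T ≤ y.1 0 →
    3 * d.excision i (y.1 0) + R₀ ≤ (d.background i).radius y.1 →
    (d.background i).radius y.1 ≤ 4 * d.excision i (y.1 0) + R₀ →
      d.flatChart y ∈ d.chart i '' {x | R₀ ≤ (d.background i).radius x.1 ∧
        ∀ j, j ≠ i → (d.background i).radius x.1 ≤ (d.background j).radius x.1}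

/-- **`PosCoreAnchored`** — the repaired stub: `PosCore` with `TubeAnchored d R₀` as one more antecedent
(after DV).  The §2 witness misses it; it is what `PosSoft` can actually target. [folklore] -/
def PosCoreAnchored : Prop :=
    let HonestCore := fun (𝓢 : Spacetime.{0} 4) (O : Set 𝓢.carrier) (k : ℕ)
        (d : FinalStateDecomposition 𝓢 O k) (R₀ : ℝ) ↦
      let B := d.background; let t := fun i ↦ (B i).time; let r := fun i ↦ (B i).radius; let Ψ := d.chart;
      (∀ i, Kerr.IsSubextremal (d.mass i) (d.spin i) ∧ 100 * d.mass i ≤ R₀ ∧ 0 < ((d.motion i).1 : E4 ≃L[ℝ] E4) (E4.basisVector 0) 0) ∧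
        (∀ i (ϱ τ₂ : ℝ), R₀ ≤ ϱ → d.τ₀ < τ₂ → Ψ i '' {x | d.τ₀ < t i x.1 ∧ t i x.1 < τ₂ ∧ r i x.1 < ϱ} ⊆ 𝓢.metric.causalPast 𝓢.timeOrientation (Ψ i '' (B i).truncTimeSlab ϱ τ₂)) ∧
        (∀ i (τ' : ℝ) (ϱ : ℝ → ℝ), Continuous ϱ → d.τ₀ < τ' → let A := Ψ i '' {x | τ' ≤ t i x.1 ∧ r i x.1 ≤ ϱ (t i x.1)}; closure A ∩ O ⊆ A) ∧
        (∀ y : d.flatDomain, d.τ₀ < y.1 0 → 𝓢.timeOrientation.IsFutureDirected (mfderiv 𝓘(ℝ, E4) (𝓡 4) d.flatChart y (E4.basisVector 0)))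
    let HonestFar := fun (𝓢 : Spacetime.{0} 4) (O : Set 𝓢.carrier) (k : ℕ)
        (d : FinalStateDecomposition 𝓢 O k) (R₀ : ℝ) ↦
      let B := d.background; let t := fun i ↦ (B i).time; let r := fun i ↦ (B i).radius; let Φ := d.flatChart;
      (∀ τ₂ : ℝ, d.τ₀ < τ₂ → Φ '' {y | d.τ₀ < y.1 0 ∧ y.1 0 < τ₂} ⊆ 𝓢.metric.causalPast 𝓢.timeOrientation (Φ '' (Minkowski.backgroundOn d.flatDomain).timeSlab τ₂)) ∧
        (∀ τ' : ℝ, d.τ₀ < τ' → closure (Φ '' {y | τ' ≤ y.1 0 ∧ ∀ i, d.excision i (y.1 0) + 1 ≤ r i y.1}) ⊆ Φ '' {y | τ' ≤ y.1 0}) ∧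
        (∀ i, ∃ T : ℝ, supCkENorm (Subtype.val '' {x : (B i).domain | T ≤ t i x.1 ∧ R₀ ≤ r i x.1 ∧ ∀ j, j ≠ i → r i x.1 ≤ r j x.1}) 0 (𝓢.deviationExtend (B i) (d.chart i)) ≤ ENNReal.ofReal (1 / (10 * ‖(((d.motion i).1 : E4 ≃L[ℝ] E4) : E4 →L[ℝ] E4)‖ ^ 2)))
    let NeckCertificate := fun (𝓢 : Spacetime.{0} 4) (O : Set 𝓢.carrier) (d : FinalStateDecomposition 𝓢 O 4)
        (R₀ : ℝ) ↦
      let B := d.background; let t := fun i ↦ (B i).time; let r := fun i ↦ (B i).radius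
      let Λ := fun i ↦ ((d.motion i).1 : E4 ≃L[ℝ] E4); let Φ := d.flatChart; let Ψ := d.chart
      let ρ := d.excision
      ∃ (R₁ τ₁ : ℝ) (ρa Rc : Fin d.N → ℝ → ℝ) (Ψa : ∀ i, (B i).domain → 𝓢.carrier),
        R₀ ≤ R₁ ∧ d.τ₀ ≤ τ₁ ∧
        (∀ i, Monotone (ρa i) ∧ Continuous (ρa i) ∧ Tendsto (fun s ↦ ρa i s / s) atTop (𝓝 0) ∧
          Tendsto (ρa i) atTop atTop ∧ ∀ s, R₁ + 1 ≤ ρa i s ∧ (τ₁ ≤ s → ρ i s + 1 ≤ ρa i s)) ∧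
        (∀ i, Monotone (Rc i) ∧ Continuous (Rc i) ∧ Tendsto (fun s ↦ Rc i s / s) atTop (𝓝 0) ∧
          Tendsto (Rc i) atTop atTop ∧ ∀ s, R₁ + 4 ≤ Rc i s) ∧
        (∀ j (y : E4), τ₁ ≤ y 0 → r j y ≤ 9 * ρa j (y 0) → r j y + 3 ≤ Rc j (t j y)) ∧
        (∀ i, let U : Set (B i).domain := {x | τ₁ < t i x.1 ∧ r i x.1 < Rc i (t i x.1) + 2}
          ContMDiffOn 𝓘(ℝ, E4) (𝓡 4) ∞ (Ψa i) U ∧ IsOpenEmbedding (U.restrict (Ψa i)) ∧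
            Ψa i '' U ⊆ d.charted) ∧
        (∀ i (x : (B i).domain), r i x.1 ≤ R₁ + 1 → Ψa i x = Ψ i x) ∧
        (∀ i (y : E4) (hy : y ∈ (B i).domain), τ₁ ≤ y 0 → 4 * ρa i (y 0) ≤ r i y →
          r i y ≤ Rc i (t i y) + 2 → ∃ hy' : y ∈ d.flatDomain, Ψa i ⟨y, hy⟩ = Φ ⟨y, hy'⟩) ∧
        (∀ i, Tendsto (fun τ ↦ 𝓢.truncDeviationCk (B i) (Ψa i) 2 (Rc i τ) τ) atTop (𝓝 0)) ∧
        (∀ i, supCkENorm (Subtype.val '' {x : (B i).domain | τ₁ ≤ t i x.1 ∧ R₁ ≤ r i x.1 ∧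
            r i x.1 ≤ Rc i (t i x.1) + 2}) 0 (𝓢.deviationExtend (B i) (Ψa i)) ≤
          ENNReal.ofReal (1 / (10 * ‖(Λ i : E4 →L[ℝ] E4)‖ ^ 2))) ∧
        (∀ i (x : (B i).domain), τ₁ ≤ t i x.1 → R₁ ≤ r i x.1 → r i x.1 ≤ Rc i (t i x.1) + 2 →
          𝓢.timeOrientation.IsFutureDirected
            (mfderiv 𝓘(ℝ, E4) (𝓡 4) (Ψa i) x ((Λ i) (E4.basisVector 0)))) ∧
        (∀ i j, i ≠ j → Disjoint (Ψa i '' {x | τ₁ < t i x.1 ∧ r i x.1 < Rc i (t i x.1) + 2})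
          (Ψa j '' {x | τ₁ < t j x.1 ∧ r j x.1 < Rc j (t j x.1) + 2})) ∧
        (∀ i (τ' : ℝ) (ϱ : ℝ → ℝ), Continuous ϱ → τ₁ < τ' → (∀ s, ϱ s < Rc i s + 2) →
          closure (Ψa i '' {x | τ' ≤ t i x.1 ∧ r i x.1 ≤ ϱ (t i x.1)}) ∩ O ⊆
            Ψa i '' {x | τ' ≤ t i x.1 ∧ r i x.1 ≤ ϱ (t i x.1)}) ∧
        (∀ (T : ℝ) (Th : Fin d.N → ℝ), τ₁ < T → (∀ j, τ₁ < Th j) →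
          (∀ j (y : E4), T < y 0 → r j y ≤ Rc j (t j y) + 2 → Th j < t j y) →
          O \ (Φ '' {y | T < y.1 0 ∧ ∀ j, 5 * ρa j (y.1 0) < r j y.1} ∪
              ⋃ j, Ψa j '' {x | Th j < t j x.1 ∧ r j x.1 < Rc j (t j x.1) + 2}) ⊆
            𝓢.metric.causalPast 𝓢.timeOrientation
              (Φ '' {y | y.1 0 = T ∧ ∀ j, 5 * ρa j (y.1 0) < r j y.1} ∪
                ⋃ j, Ψa j '' {x | t j x.1 = Th j ∧ r j x.1 < Rc j (t j x.1) + 2}))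
      ∀ (X : Type) [TopologicalSpace X] [ChartedSpace E3 X] [IsManifold (𝓡 3) ∞ X] [ConnectedSpace X]
        (D : InitialDataSet (𝓡 3) X), D ∈ admissibleVacuumData X →
        ∀ 𝒟 : VacuumCauchyDevelopment D, 𝒟.IsMaximal →
        ∀ (O : Set 𝒟.carrier) (d : FinalStateDecomposition 𝒟.toSpacetime O 4) (R₀ : ℝ),
          O = exteriorOf 𝒟.toCauchyDevelopment d.charted →
          HonestCore 𝒟.toSpacetime O 4 d R₀ → HonestFar 𝒟.toSpacetime O 4 d R₀ →
          (∀ i j : Fin d.N, i ≠ j →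
            ((d.motion i).1 : E4 ≃L[ℝ] E4) (E4.basisVector 0) ≠ ((d.motion j).1 : E4 ≃L[ℝ] E4) (E4.basisVector 0)) →
          TubeAnchored d R₀ → 0 < d.N → NeckCertificate 𝒟.toSpacetime O d R₀

/-- The repaired stub is weaker than the refuted one (monotonicity record): `PosCore → PosCoreAnchored`.
[folklore] -/
theorem posCoreAnchored_of_posCore (h : PosCore) : PosCoreAnchored := by
  intro X i₁ i₂ i₃ i₄ D hD 𝒟 h𝒟 O d R₀ hO hc hf hDV _ hN
  exact h X D hD 𝒟 h𝒟 O d R₀ hO hc hf hDV hN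

/-! ## §5 Other attacks tried (cycle 1) -/

/-- Record of the cheap attacks of cycle 1 and why each resists (no Lean content; `True`).
(a) JUNK WITNESSES for `NeckGapDecay`'s conclusion (would make the crux ⇔ `NecksCertifyR`): none — G2
pins `Ψg = Ψᵢ` inside `R₁+1`, `Ψg` is smooth across `r = R₁+1` on the open tube, and the `C²` deviation
from boosted Kerr must → 0 at FIXED radii `R₁+1 < r < R₁+2` where Kerr's `M/r` is not small, so no
`Φ`-borrowed or constant chart qualifies; the wall `W(x⁰) ≥ 3ρᵢ(x⁰)+2` is evaluated at lab time and is
unconstrained before `τ₁`, which only trims far-away early points.  (b) VACUITY of the antecedent: no —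
`N = 0` over Minkowski data inhabits it and there both sides are theorems (p116183/p116546).
(c) EXCISION PROFILES: `tendsto_excision_div` allows bounded, non-monotone, even negative `ρᵢ`; harmless
here (re-excision by `max` preserves every clause — the rattack seat's `ReExcise.lean`).  (d) THIN-SHELL
RIGIDITY (the planner's own worry): resolved FOR the provers on paper — with `C⁰` strain `ε₀` and
`|D²T| ≤ Cε₁` on the overlap shell `{ρ < r < 3ρ}`, the local Lorentz fit may wander by `O(1)` through
BMO-vortices (John 1961: `z ↦ z e^{iε log|z−p|}` patterns of core `≥ ε₀/ε₁` and outer size `ρ ≥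
e^{1/ε₀}`), but John's displacement estimate `‖T − (Rx+b)‖_∞ ≤ C ε₀ ρ` (BMO + Morrey on a John domain,
scale-free) makes the cutoff blend `χT + (1−χ)(Rx+b)` over radial length `ρ` cost strain `O(ε₀)`; the
Poincaré fit moves by `≤ Cε₀` per time `ρ`, so the time-blend at radius `4ρₐ` costs `ε₀ρₐ/ρ`, and
`ρₐ := ρ · min(√(t/ρ), ε̄₀^{-1/2})` gives both `ρₐ/ρ → ∞` (log-room for the belt trick) and
`ε₀ρₐ/ρ → 0`.  The Lorentzian Korn inequality behind the Lorentz-group version holds because the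
`η`-Killing operator has injective symbol (signature does not enter); the a-priori `‖DT‖` bound comes from
the timelike legs as the planner says.  (e) GARBAGE FAR CHARTS / K12: a hole chart's off-Voronoi far
region is typed only by open-embedding + `Hc`(2)(3); a "finger" into another hole's interior would
enlarge `O` by its chronological past, whose uncovered interior part would have to lie in `J⁻` of the
finger's floor, a 3-ball, which cannot causally shadow an `S²`-essential region of the interior — so the
covering clause excludes it (paper); K12 for re-gauged charts remains bookkeeping of the landed N2 kind.
(f) LABEL PERMUTATIONS: §2 — the one attack that lands. [folklore] -/
theorem attacksTried : True := trivial

end Summit.FinalStateConjecture.FinalStateConjecture.Cruxes.GapDecaySuffices.Disproof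

end
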